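import Literature.NumberTheory.Rogawski1990.U3PrincipalSeriesReducibility
import Literature.NumberTheory.Rogawski1990.CMLocalAPacketMembers
import Literature.NumberTheory.Automorphic.JacquetModule
import HarnessLib

/-!
# [Casselman1995 Thm. 4.4.6; Rogawski1990 §12.2] CASSELMAN'S SQUARE-INTEGRABILITY CRITERION for the quasi-split `U(3)` over a `p`-adic field, (⇒) direction,
# in the Borel–Jacquet-quotient form: the exponents of a square-integrable representation DECAY on the dominant cone (node N7 of topic T7)

Topic `NumberTheory/Rogawski1990`; namespace `Literature.NumberTheory.Rogawski1990`.  ONE NAMED FACT `u3_squareIntegrable_jacquetExponent_decay : Prop` (a `def`,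
statement only; net debt +1, a PRINTED CITATION of generic `p`-adic representation theory specialised to the tree's `U(Φ₃)(L⁺_v)`), no instance, no notation, no `sorry`.
Cell `hodgecm-mathlib` (D-0151), crux H413, programme P2; topic T7 of director g16's PLAN-THROUGHPUT-P2-P5 §4 (seat typ-T7b; map `F0/P2/T7b-TREE.md`, node N7; assigned
«N7 = YOURS» by typ-T7a 14:53:05Z).  HC_CM is proved only modulo the printed citations («named inputs remaining 2») until rung 0 closes; this file proves nothing.

WHAT IT IS FOR.  The local half of letter #75 D7α (★-pending T7 root `GelbartRogawski1991.xiLocalPacket_nonsplit_isThetaPair`; Lines draft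
`F0/P2/Lines-draft/T7b_LocalThetaDichotomy.lean`, stub K1⁺ `StubThetaInPSnonL2`) needs the LABEL «the `U(1)`-theta type `X_v(μ, ε, χ_f)` of the occurring class is
`πⁿ(ξ_v)`, the NON-square-integrable constituent of `i_G(χ_ξ)`, not `π²(ξ_v)`» [GelbartRogawski1991 §1.4 p. 450: «`πⁿ(ϱ_v)` [is] the Langlands quotient of the principal
series»; Rogawski1990 §12.2 (2) p. 174: «It follows from the theory of matrix coefficients that `πⁿ(ξ)` is non-tempered»].  «The theory of matrix coefficients» = Casselman's
criterion: by ★-pending `GelbartRogawski1991.thetaType_nonsplit_jacquetModule` (typ-T7a, p826177) the Borel–Jacquet module of `X_v` is ONE-dimensional with the torus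
`d(α, β, ᾱ⁻¹)` acting by the raw weight `μ_v(α)‖α‖^{1/2}ψθ(β)` (Kudla's evaluation-at-0 weight, [GR91 (3.2.2)]); since `‖μ_v(α)‖·‖α‖^{1/2} = ‖α‖^{1/2} ≥ ‖α‖ = δ_B(d)^{1/2}`
on the dominant cone `‖α‖ < 1`, the criterion below says `X_v` is NOT square-integrable modulo the centre — so under ★ NF1 `KeysCaseTwo` it is `πⁿ(ξ_v)` (★
`KeysCaseTwo.labels_unique`).  (For `π²(ξ_v) ⊂ i_G(χ_ξ)` the raw quotient weight is `‖α‖^{3/2} < ‖α‖`: no contradiction, as it must be.)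

THE PRINT.  [Casselman1995] W. Casselman, *Introduction to the theory of admissible representations of `p`-adic reductive groups* (notes, 1974∕1995), **Thm. 4.4.6**, as
RESTATED VERBATIM in the held [KatoTakano2009] S. Kato, K. Takano, *Square integrability of representations on p-adic symmetric spaces* (arXiv:0902.2302 = IMRN 2010), p. 3
(`lit read`, chunk p0003 L66–86): «We say that `π` is square integrable if all the usual matrix coefficients (defined by smooth linear forms) are square integrable on `G/Z_G`.
For each parabolic subgroup `P` of `G` with the `F`-split component `A_P`, let `(π_P, V_P)` be the normalized Jacquet module of `π` along `P` and `Exp_{A_P}(π_P)` the set of all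
quasi-characters `χ` of `A_P` having non-zero generalized eigenvectors in `V_P`. Let `A_P^-` and `A_P^1` denote the dominant part of `A_P` and the `𝒪_F`-points of `A_P`
respectively.  Casselman's criterion ([C]). The representation `π` is square integrable if and only if for every parabolic subgroup `P`, the condition `|χ(a)| < 1` holds for all
`χ ∈ Exp_{A_P}(π_P)` and `a ∈ A_P^- ∖ Z_G A_P^1`.»  SPECIALISATION TYPED HERE ((⇒) direction, the only one the pay-down needs; one parabolic): `G = U(Φ₃)(L⁺_v)` at a finite place
`v` of `L⁺` NON-SPLIT in `L` (so `G` has `L⁺_v`-rank one, the upper-triangular Borel `B = TN` (★ `cmBorelTriple L 3 v`) is the only proper parabolic up to conjugacy, `A_B^-` is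
`{d(a, 1, a⁻¹) : |a| ≤ 1}` and the centre `Z ≅ E¹_v` is compact); the tree's Jacquet module ★ `Representation.jacquetModule` is the UNNORMALISED `N`-coinvariant module `π_N`,
so a normalised exponent `χ` is a raw exponent `χ_raw = χ·δ_B^{1/2}` and the condition reads `|χ_raw(t)| < δ_B(t)^{1/2}`; on `t = d(α, β, ᾱ⁻¹) ∈ T` one has `δ_B(t) = ‖α‖²`
(`N` = Heisenberg group `E_v ⊕ L⁺_v`, weights `‖α∕β̄‖·‖αᾱ‖_{L⁺} = ‖α‖²`; ★ `modularCharacter_borelAdelic_torus` «`‖d₀‖²`», ★ `rootDeltaChar`), `‖α‖ = |α|_{E_v}` = ★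
`UnitaryGroup.unitModulusChar (LocalRing L v)` at the `α`-coordinate ★ `torusEntry … 0` (the coordinate of ★ `cmXiTorusChar`, «`d(α, β, ᾱ⁻¹) ↦ α`»); every character `χ` of `T`
through which `π_N` maps NON-TRIVIALLY (a one-dimensional QUOTIENT of `π_N`) restricts on `A_B` to an element of `Exp` (a quotient eigencharacter is a generalised eigencharacter),
and `|χ(t)|` depends on `t ∈ T` only through `‖α‖` (the image of the compact `T(𝒪)·E¹`-part lies in the unit circle).  HENCE THE TYPED STATEMENT: an irreducible admissible
square-integrable (mod centre, ★ `Representation.IsSquareIntegrableModCenter` for a Haar measure on `G ⧸ Z`) `π` of `U(Φ₃)(L⁺_v)` has `‖χ(t)‖ < ‖α(t)‖` for every quotient character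
`χ` of its Borel–Jacquet module and every `t ∈ T` with `‖α(t)‖ < 1`.  [Rogawski1990 §12.2 pp. 173–174] is the `U(3)` locus («by Jacquet's theorem … theory of matrix
coefficients»); [BernsteinZelevinsky1977 §2], [Silberger1979 §4.5] print the same criterion.  SCOPE ∕ NOT ASSERTED: the (⇐) direction; split `v` (rank two: the cone has two
walls — deliberately excluded by the non-split hypothesis); generalised (non-semisimple) exponents beyond quotient characters; archimedean places.

* `u3_squareIntegrable_jacquetExponent_decay` — the named fact.

## References
* [Casselman1995] W. Casselman, *Introduction to the theory of admissible representations of p-adic reductive groups*, unpublished notes (1995 version): Thm. 4.4.6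
  (square-integrability criterion), §4.4 (the dominant cone `A^-`), Thm. 3.2.4 (Frobenius reciprocity).
* [KatoTakano2009] S. Kato, K. Takano, *Square integrability of representations on p-adic symmetric spaces*, arXiv:0902.2302 (IMRN 2010): p. 3, «Casselman's criterion ([C])»
  (held; the verbatim restatement quoted above).
* [Rogawski1990] J. Rogawski, Ann. of Math. Stud. 123 (1990): §12.1 p. 172, §12.2 (2) pp. 173–174.
* [GelbartRogawski1991] S. Gelbart, J. Rogawski, Invent. Math. 105 (1991): §1.4 p. 450 («Langlands quotient»), §3.2 (3.2.2) p. 457.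
* [BernsteinZelevinsky1977] Ann. sci. ÉNS 10 (1977) §2; [Silberger1979] A. Silberger, *Introduction to harmonic analysis on reductive p-adic groups*, §4.5.
-/

set_option autoImplicit false

noncomputable section

open NumberField IsDedekindDomain MeasureTheory
open scoped Matrix NNReal

namespace Literature.NumberTheory.Rogawski1990

open Literature.NumberTheory Literature.NumberTheory.Automorphic Literature.NumberTheory.Automorphic.UnitaryGroup

set_option synthInstance.maxHeartbeats 400000 in
set_option maxHeartbeats 8000000 in
/-- **[Casselman1995 Thm. 4.4.6, (⇒), for `U(Φ₃)(L⁺_v)` at a non-split place; as restated in KatoTakano2009 p. 3] — the Borel–Jacquet exponents of a square-integrable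
representation decay on the dominant cone.**  Let `L` be a CM field, `v` a finite place of `L⁺` that does NOT split in `L`, `G = U(Φ₃)(L⁺_v)` (★ `Gqs L v`) with its
upper-triangular Borel triple `(B, T, N)` (★ `cmBorelTriple L 3 v`), and `μZ` a Haar measure on `G ⧸ Z(G)`.  If `π` is an irreducible, smooth, admissible representation of `G`
which is square-integrable modulo the centre (★ `Representation.IsSquareIntegrableModCenter μZ`: all smooth matrix coefficients are `L²` on `G ⧸ Z`), then for every continuous
character `χ : T → ℂˣ` and every NON-ZERO `T`-intertwining map from the (unnormalised) Jacquet module `π_N` (★ `Representation.jacquetModule`) to the line `ℂ_χ` — i.e. for every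
one-dimensional quotient exponent `χ` of `π_N` — and every `t = d(α, β, ᾱ⁻¹) ∈ T` in the open dominant cone `‖α‖ < 1` (`‖·‖` = ★ `unitModulusChar` of `L_w = L ⊗_{L⁺} L⁺_v`,
the `α`-coordinate ★ `torusEntry … 0`), one has `‖χ(t)‖ < ‖α‖` (`= δ_B(t)^{1/2}`; print's normalised form `|χ·δ_B^{-1/2}(a)| < 1` on `A⁻ ∖ Z A¹`).  Consumer: with the
one-dimensional Jordan–Hölder∕Jacquet computation of the theta type (raw weight `μ_v(α)‖α‖^{1/2}ψθ(β)`, `‖·‖ ≥ ‖α‖` on the cone) it yields «`X_v(μ, ε, χ_f)` is not `L²` mod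
centre», i.e. `= πⁿ(ξ_v)` under ★ `KeysCaseTwo`.  Only the (⇒) direction and only quotient characters are asserted; non-split `v` only.
[cite: Casselman1995, Thm. 4.4.6] [cite: KatoTakano2009, p. 3 («Casselman's criterion»)] [cite: Rogawski1990, §12.2 (2) pp. 173–174] -/
def u3_squareIntegrable_jacquetExponent_decay : Prop :=
  ∀ (L : Type) [Field L] [NumberField L] [IsCMField L] (v : HeightOneSpectrum (𝓞 ↥(maximalRealSubfield L))),
    (∀ w : PlacesOver L v, IsCMField.complexConj L • w.1 = w.1) →
    ∀ [MeasurableSpace (Gqs L v ⧸ Subgroup.center (Gqs L v))] [BorelSpace (Gqs L v ⧸ Subgroup.center (Gqs L v))]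
      (μZ : Measure (Gqs L v ⧸ Subgroup.center (Gqs L v))) [μZ.IsHaarMeasure],
    ∀ (V : Type) [AddCommGroup V] [Module ℂ V] (π : Representation ℂ (Gqs L v) V),
      π.IsIrreducible → π.IsSmooth → π.IsAdmissible → π.IsSquareIntegrableModCenter μZ →
    ∀ (χ : ↥(torusU (conjLocal L (IsCMField.complexConj L) v) (cmLocalForm L 3 v)) →* ℂˣ),
      Continuous (fun t => ((χ t : ℂˣ) : ℂ)) →
    ∀ (f : (π.jacquetModule (cmBorelTriple L 3 v)).IntertwiningMap
        ((Representation.trivial ℂ ↥(torusU (conjLocal L (IsCMField.complexConj L) v) (cmLocalForm L 3 v)) ℂ).twist χ)),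
      f.toLinearMap ≠ 0 →
    ∀ (t : ↥(torusU (conjLocal L (IsCMField.complexConj L) v) (cmLocalForm L 3 v))),
      unitModulusChar (LocalRing L v) (torusEntry (conjLocal L (IsCMField.complexConj L) v) (cmLocalForm L 3 v) 0 t) < 1 →
      ‖((χ t : ℂˣ) : ℂ)‖ < ((unitModulusChar (LocalRing L v) (torusEntry (conjLocal L (IsCMField.complexConj L) v) (cmLocalForm L 3 v) 0 t) : ℝ≥0) : ℝ)

end Literature.NumberTheory.Rogawski1990

end
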